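import Literature.AlgebraicGeometry.Motives.HodgeThetaSubalgebraUnitary
import HarnessLib

/-!
# A polarized weight-one Hodge structure of rank four with an imaginary quadratic field `ℚ[φ]` of Hodge
# endomorphisms has a Hodge endomorphism outside `ℚ[φ]` (Shimura 1963, Moonen–Zarhin 1999 (2.2): the
# endomorphism algebra of a complex abelian SURFACE is never an imaginary quadratic field)

Family `hodge`, layer `Literature/AlgebraicGeometry/Motives`. Research context: cell `pub-hodge-ring2` (HONEST
FRAMING: research route conditional on HC_CM; not a corollary; Q11.4-sentence-2 already refuted in dim ≥ 3),
Literature lane, programme R12 «simple abelian surfaces» (the Tankeev–Ribet theorem at `p = 2`, fact-free), the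
Hodge-theoretic half. THEOREMS ONLY — no definition, no named fact (D-0026), no `sorry`; axioms standard. This is
the one input of Moonen–Zarhin's list of the endomorphism algebras of SIMPLE abelian surfaces that the tree did not
have: type IV(1,1) (`End⁰(X)` an imaginary quadratic field) does not occur in dimension `2`.

THE PRINTED STATEMENTS (held texts, read on the materialised pages).
* B. Moonen, Yu. Zarhin, *Hodge classes on abelian varieties of low dimension*, Math. Ann. 315 (1999) 711–733
  [`paper:arxiv-math_9901113` p0005 L53–L78], §2 (2.2), simple `X` of dimension `g = 2`: "There are four
  cases. Type 1(1): `X` is an abelian surface with `End⁰(X) = ℚ` … Type 1(2): `End⁰(X) = F` is a real quadratic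
  field … Type 2(1): `D = End⁰(X)` is a quaternion algebra over `ℚ`, split at `∞` … Type 4(2,1): `End⁰(X) = F` is
  a quartic CM-field not containing an imaginary quadratic subfield." — in particular `End⁰(X)` is never an
  imaginary quadratic field (nor a definite quaternion algebra: the tree's
  `HodgeTheory.QuaternionMinimalPowersHodgeClasses`, `AbelianVariety.dim_ne_two_of_isTotallyDefinite_rat`).
* K. Hulek, R. Laface, *On the Picard numbers of abelian varieties*, Ann. Sc. Norm. Super. Pisa (2019)
  [`paper:arxiv-1703.05882` p0010 L19–L43], Prop. 5.1: a general member of Shimura's family has `End_ℚ(X) = ι(F)`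
  "unless we are in one of the five following exceptional cases: … • `F` is of type IV, `Σ r_ν s_ν = 0`; • `F` is
  of type IV, `m := g/d²e₀ = 2`, `d = 1` and `r_ν = s_ν = 1` …", and "under the assumption that our abelian
  variety `X` be simple, one can show that these cases never occur: … • `X` is isogenous to `Y^{d²m}`, where `Y` is
  an abelian variety of dimension `e₀` …; • `End_ℚ(X)` contains a totally indefinite quaternion algebra `F̃` over
  `K₀` with `F = K ⊂ F̃`, so that `F = K ⊂ F̃ ⊂ End_ℚ(X) = F`, contradiction" — "see the original paper by Shimura
  [Shimura 1963] … or [Birkenhake–Lange] for a modern approach". For a SURFACE with an imaginary quadratic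
  `K ⊆ End⁰(X)` (`e₀ = 1`, `d = 1`, `m = 2`) the multiplicities `(r, s)` of `K` on `T₀X` are `(2,0)` (case 3) or
  `(1,1)` (case 4).

WHAT THIS FILE PROVES — the two exceptional cases on the `ℚ`-Hodge structure, by linear algebra and the
Hodge–Riemann relations (NOT Shimura's moduli argument). Data: an effective polarized `ℚ`-Hodge structure `H` of
weight `1` on `V`, `dim_ℚ V = 4` (think `V = H¹(X(ℂ); ℚ)` of an abelian surface), `ψ` a polarization, and
`φ ∈ End_Hdg(V)` with `φ² = -d`, `d ∈ ℚ_{>0}` (so `ℚ[φ] ≅ ℚ(√-d)`); `μ = i√d`, `W_{±μ} ⊆ V_ℂ` the eigenspaces of `φ_ℂ`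
(`V_ℂ = W_μ ⊕ W_{-μ}`, `conj W_μ = W_{-μ}`), `V^{1,0} = (V^{1,0} ∩ W_μ) ⊕ (V^{1,0} ∩ W_{-μ})`.
* §1 (algebra of `φ`, no Hodge theory) `exists_adaptedBasis` — a basis `b₀, b₁ = φb₀, b₂, b₃ = φb₂` (`V ≅ K²`);
  `exists_commuting_not_mem` — the projection `π` onto `ℚb₀ ⊕ ℚb₁` along `ℚb₂ ⊕ ℚb₃` commutes with `φ` and is
  not in `ℚ + ℚφ`; `exists_balancedForm` — the alternating form
  `g = b₀^* ∧ b₂^* − d·b₁^* ∧ b₃^*` (the rational part of the `K`-bilinear determinant on `K²`) is non-zero and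
  `ℚ[φ]`-BALANCED, `g(φx, y) = g(x, φy)`.
* §2 (weight one) `mem_endAlg_of_mapsTo_piece` — `u ∈ End_Hdg(V)` as soon as `u_ℂ V^{1,0} ⊆ V^{1,0}`;
  `isCompl_piece` — `V_ℂ = V^{1,0} ⊕ V^{0,1}`; `mem_piece_of_forall_form_eq_zero` — **`V^{1,0}` is LAGRANGIAN**:
  `ψ_ℂ(z, V^{1,0}) = 0 ⟹ z ∈ V^{1,0}` (first and second Hodge–Riemann relations).
* §3 base change of the identities `ψ(uv, w) = g(v, w)`, `g(v, w) = -g(w, v)`, and `g`-orthogonality of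
  eigenvectors of a `g`-balanced operator with distinct eigenvalues; the explicit splitting `x = x₊ + x₋`.
* §4 THE TWO CASES. `piece_eq_eigenspace` — multiplicities `(2,0)`/`(0,2)`: if `V^{1,0} ∩ W_{-μ} = 0` then
  `V^{1,0} = W_μ` (so `V^{0,1} = W_{-μ}`), and (`mem_endAlg_of_commute`) EVERY rational operator commuting with
  `φ` is a Hodge endomorphism — in particular `π`; this is case (3), "`X ∼ Y²`" with `Y` a CM elliptic curve, on
  the Hodge structure. `exists_mem_endAlg_of_balancedForm` — multiplicities `(1,1)`: the operator `u = ψ⁻¹g`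
  (`ψ(uv, w) = g(v, w)`) is a Hodge endomorphism, because `g_ℂ` vanishes on `V^{1,0} × V^{1,0}` (the lines
  `V^{1,0} ∩ W_{±μ}` are `g_ℂ`-isotropic as `g` is alternating, and `g_ℂ(W_μ, W_{-μ}) = 0` as `g` is balanced) and
  `V^{1,0}` is Lagrangian; and `u ∈ ℚ + ℚφ` forces `g = 0`: for `0 ≠ a ∈ ℚ + ℚφ` and `0 ≠ p ∈ V^{1,0} ∩ W_μ`,
  `ψ_ℂ(a p, conj(a p)) = conj(λ) g_ℂ(p, conj p) = 0` (`conj p ∈ W_{-μ}`) contradicts the second Hodge–Riemann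
  relation. This is case (4): `u` is `ℚ[φ]`-ANTILINEAR in effect, and `ℚ[φ] + ℚ[φ]u ⊆ End_Hdg(V)` is the
  (indefinite) quaternion algebra of Hulek–Laface's argument.
* MAIN: **`ImaginaryQuadraticRankFour.exists_mem_endAlg_not_mem`** — there is `u ∈ End_Hdg(V)` with
  `u ∉ ℚ + ℚφ`; `not_forall_mem_endAlg_eq` (the hypothesis shape `hE` of the tree's `UnitaryTheta` files is
  contradictory in rank four); **`three_le_finrank_endAlg`** — `dim_ℚ End_Hdg(V) ≥ 3`.
The geometric reading (`End⁰` of an abelian surface is never imaginary quadratic; the `p = 2` case of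
Tankeev–Ribet) is `HodgeTheory/SimpleAbelianSurfacePowersHodgeClasses`.

## References
* [MoonenZarhin1999LowDim] B. Moonen, Yu. Zarhin, Math. Ann. 315 (1999) 711–733, §2 (2.2) (p. 715).
* [HulekLaface2019PicardNumbersAV] K. Hulek, R. Laface, Ann. Sc. Norm. Super. Pisa Cl. Sci. (5) 19 (2019),
  Prop. 5.1 and its proof (arXiv:1703.05882, p. 10).
* [Shimura1963AnalyticFamilies] G. Shimura, *On analytic families of polarized abelian varieties and automorphic
  functions*, Ann. of Math. 78 (1963) 149–192, §4 (the exceptional cases; read through Hulek–Laface Prop. 5.1).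
* [Deligne1982HodgeCycles] P. Deligne, *Hodge cycles on abelian varieties*, LNM 900 (1982), §4 p. 30
  (`H¹ ⊗ ℂ = ⊕_σ H¹_σ` under a field of endomorphisms; `conj` exchanges `H¹_σ` and `H¹_σ̄`).
* [VoisinHodgeI2002] C. Voisin, *Hodge Theory and Complex Algebraic Geometry I*, §7.1.2 Def. 7.7 (polarized
  Hodge structures, Hodge–Riemann relations), §7.2.2.
* [DeligneHodgeII1971] P. Deligne, *Théorie de Hodge II*, 1.2.5, 2.1.6 (Hodge filtration, morphisms).
-/

noncomputable section

open scoped TensorProduct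

namespace Literature.AlgebraicGeometry.Motives

namespace HodgeStructure

universe u

variable {V : Type u} [AddCommGroup V] [Module ℚ V]

/-! ### §1 Linear algebra of an operator `φ` with `φ² = -d`, `d > 0`, on a four-dimensional `ℚ`-space -/

section Algebra

/-- `v ≠ 0 ⟹ v, φ v` linearly independent (`φ² = -d < 0` has no rational eigenvalue). [folklore] -/
private theorem ImaginaryQuadraticRankFour.linearIndependent_pair {φ : Module.End ℚ V} {d : ℚ} (hd : 0 < d)
    (hφ2 : φ * φ = -(d • 1)) {v : V} (hv : v ≠ 0) : LinearIndependent ℚ ![v, φ v] := by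
  rw [LinearIndependent.pair_iff]
  intro s t hst
  have hφφ : φ (φ v) = -(d • v) := by
    have h := LinearMap.congr_fun hφ2 v
    rwa [Module.End.mul_apply, LinearMap.neg_apply, LinearMap.smul_apply, Module.End.one_apply] at h
  by_cases ht : t = 0
  · subst ht
    rw [zero_smul, add_zero, smul_eq_zero] at hst
    exact ⟨hst.resolve_right hv, rfl⟩
  · exfalso
    have hφv : φ v = (-(s / t)) • v := by
      have h : t • φ v = -(s • v) := eq_neg_of_add_eq_zero_right hst
      calc φ v = t⁻¹ • (t • φ v) := by rw [smul_smul, inv_mul_cancel₀ ht, one_smul]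
        _ = _ := by rw [h, smul_neg, smul_smul, neg_smul, div_eq_inv_mul]
    have hsq : ((s / t) ^ 2 + d) • v = 0 := by
      have h := hφφ
      rw [hφv, map_smul, hφv, smul_smul, neg_mul_neg, ← sq] at h
      rw [add_smul, h, neg_add_cancel]
    rcases smul_eq_zero.1 hsq with h | h
    · have : (0 : ℚ) < (s / t) ^ 2 + d := by positivity
      exact this.ne' h
    · exact hv h

/-- `φ (φ x) = -d x`. [folklore] -/
private theorem ImaginaryQuadraticRankFour.apply_apply {φ : Module.End ℚ V} {d : ℚ} (hφ2 : φ * φ = -(d • 1))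
    (x : V) : φ (φ x) = -(d • x) := by
  have h := LinearMap.congr_fun hφ2 x
  rwa [Module.End.mul_apply, LinearMap.neg_apply, LinearMap.smul_apply, Module.End.one_apply] at h

/-- **An adapted basis.** If `dim_ℚ V = 4` and `φ² = -d`, `d > 0`, there is a basis `(b₀, b₁, b₂, b₃)` of `V`
with `φ b₀ = b₁`, `φ b₁ = -d b₀`, `φ b₂ = b₃`, `φ b₃ = -d b₂` (i.e. `V ≅ K²` for `K = ℚ(√-d) = ℚ[φ]`: take
`v ≠ 0`, `w ∉ ℚv + ℚφv`; a relation `c w + e φw ∈ ℚv + ℚφv` forces `(c² + e²d) w ∈ ℚv + ℚφv`). [folklore] -/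
private theorem ImaginaryQuadraticRankFour.exists_adaptedBasis [Module.Finite ℚ V] {φ : Module.End ℚ V} {d : ℚ}
    (hd : 0 < d) (hφ2 : φ * φ = -(d • 1)) (hV : Module.finrank ℚ V = 4) :
    ∃ b : Module.Basis (Fin 4) ℚ V,
      φ (b 0) = b 1 ∧ φ (b 1) = -(d • b 0) ∧ φ (b 2) = b 3 ∧ φ (b 3) = -(d • b 2) := by
  classical
  haveI : Nontrivial V := Module.nontrivial_of_finrank_pos (R := ℚ) (by omega)
  obtain ⟨v, hv⟩ := exists_ne (0 : V)
  have hφφ := ImaginaryQuadraticRankFour.apply_apply hφ2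
  set L := Submodule.span ℚ (Set.range ![v, φ v]) with hL
  have hLrank : Module.finrank ℚ L = 2 := by
    rw [hL, finrank_span_eq_card (ImaginaryQuadraticRankFour.linearIndependent_pair hd hφ2 hv),
      Fintype.card_fin]
  have hLtop : L ≠ ⊤ := by
    intro h
    have h' := hLrank
    rw [h, finrank_top, hV] at h'
    omega
  obtain ⟨w, -, hw⟩ := SetLike.exists_of_lt (lt_top_iff_ne_top.2 hLtop)
  have hvL : v ∈ L := Submodule.subset_span ⟨0, rfl⟩
  have hφvL : φ v ∈ L := Submodule.subset_span ⟨1, rfl⟩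
  -- `L` is `φ`-stable
  have hφL : ∀ x ∈ L, φ x ∈ L := by
    intro x hx
    rw [hL, Submodule.mem_span_range_iff_exists_fun] at hx
    obtain ⟨cf, rfl⟩ := hx
    rw [Fin.sum_univ_two, map_add, map_smul, map_smul]
    simp only [Matrix.cons_val_zero, Matrix.cons_val_one]
    rw [hφφ]
    exact Submodule.add_mem _ (Submodule.smul_mem _ _ hφvL)
      (Submodule.smul_mem _ _ (Submodule.neg_mem _ (Submodule.smul_mem _ _ hvL)))
  -- the family `(v, φ v, w, φ w)` is linearly independent
  have hli : LinearIndependent ℚ ![v, φ v, w, φ w] := by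
    rw [Fintype.linearIndependent_iff]
    intro g hg
    rw [Fin.sum_univ_four] at hg
    simp only [Matrix.cons_val_zero, Matrix.cons_val_one, Matrix.cons_val] at hg
    -- `c w + e φw ∈ L` and `φ` of it too
    have h1 : g 2 • w + g 3 • φ w ∈ L := by
      have h : g 2 • w + g 3 • φ w = -(g 0 • v + g 1 • φ v) := by
        rw [eq_neg_iff_add_eq_zero, ← hg]; abel
      rw [h]
      exact Submodule.neg_mem _ (Submodule.add_mem _ (Submodule.smul_mem _ _ hvL)
        (Submodule.smul_mem _ _ hφvL))
    have h2 : g 2 • φ w - (g 3 * d) • w ∈ L := by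
      have h := hφL _ h1
      rw [map_add, map_smul, map_smul, hφφ, smul_neg, ← sub_eq_add_neg, smul_smul] at h
      exact h
    have h3 : (g 2 ^ 2 + g 3 ^ 2 * d) • w ∈ L := by
      have h : (g 2 ^ 2 + g 3 ^ 2 * d) • w = g 2 • (g 2 • w + g 3 • φ w) - g 3 • (g 2 • φ w - (g 3 * d) • w) := by
        module
      rw [h]
      exact Submodule.sub_mem _ (Submodule.smul_mem _ _ h1) (Submodule.smul_mem _ _ h2)
    have h23 : g 2 = 0 ∧ g 3 = 0 := by
      by_contra hne
      have hpos : 0 < g 2 ^ 2 + g 3 ^ 2 * d := by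
        rcases not_and_or.1 hne with h | h
        · have : 0 < g 2 ^ 2 := by positivity
          nlinarith [sq_nonneg (g 3), hd.le]
        · have : 0 < g 3 ^ 2 := by positivity
          nlinarith [sq_nonneg (g 2)]
      exact hw ((Submodule.smul_mem_iff L hpos.ne').1 h3)
    obtain ⟨h2z, h3z⟩ := h23
    rw [h2z, h3z, zero_smul, zero_smul, add_zero, add_zero] at hg
    obtain ⟨h0z, h1z⟩ :=
      (LinearIndependent.pair_iff.1 (ImaginaryQuadraticRankFour.linearIndependent_pair hd hφ2 hv)) _ _ hg
    intro i
    fin_cases i <;> assumption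
  refine ⟨basisOfLinearIndependentOfCardEqFinrank hli (by rw [Fintype.card_fin, hV]), ?_, ?_, ?_, ?_⟩ <;>
    simp only [coe_basisOfLinearIndependentOfCardEqFinrank, Matrix.cons_val_zero, Matrix.cons_val_one,
      Matrix.cons_val] <;> first | rfl | exact hφφ _

/-- **A `φ`-linear non-scalar operator**: with an adapted basis, the projection `π` onto `ℚb₀ ⊕ ℚb₁` along
`ℚb₂ ⊕ ℚb₃` commutes with `φ` and is not of the form `x + yφ` (it kills `b₂ ≠ 0` and fixes `b₀ ≠ 0`). [folklore] -/
private theorem ImaginaryQuadraticRankFour.exists_commuting_not_mem [Module.Finite ℚ V] {φ : Module.End ℚ V}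
    {d : ℚ} (hd : 0 < d) (hφ2 : φ * φ = -(d • 1)) (hV : Module.finrank ℚ V = 4) :
    ∃ π : Module.End ℚ V, π * φ = φ * π ∧ ¬ ∃ x y : ℚ, π = x • 1 + y • φ := by
  classical
  obtain ⟨b, h0, h1, h2, h3⟩ := ImaginaryQuadraticRankFour.exists_adaptedBasis hd hφ2 hV
  refine ⟨b.constr ℚ ![b 0, b 1, 0, 0], ?_, ?_⟩
  · refine b.ext fun i => ?_
    fin_cases i <;>
      simp only [Fin.zero_eta, Fin.mk_one, Fin.reduceFinMk, Module.End.mul_apply, Module.Basis.constr_basis,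
        Matrix.cons_val_zero, Matrix.cons_val_one, Matrix.cons_val, h0, h1, h2, h3, map_neg, map_smul,
        map_zero, neg_zero, smul_zero]
  · rintro ⟨x, y, hxy⟩
    have hb2 := LinearMap.congr_fun hxy (b 2)
    rw [Module.Basis.constr_basis, LinearMap.add_apply, LinearMap.smul_apply, LinearMap.smul_apply,
      Module.End.one_apply, h2] at hb2
    simp only [Matrix.cons_val] at hb2
    -- `x b₂ + y b₃ = 0` forces `x = y = 0`
    have hxy0 : x = 0 ∧ y = 0 := by
      have hli := Fintype.linearIndependent_iff.1 b.linearIndependent ![0, 0, x, y] (by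
        rw [Fin.sum_univ_four]
        simp only [Matrix.cons_val_zero, Matrix.cons_val_one, Matrix.cons_val, zero_smul, zero_add]
        exact hb2.symm)
      exact ⟨hli 2, hli 3⟩
    obtain ⟨rfl, rfl⟩ := hxy0
    rw [zero_smul, zero_smul, add_zero] at hxy
    have hb0 := LinearMap.congr_fun hxy (b 0)
    rw [Module.Basis.constr_basis, LinearMap.zero_apply] at hb0
    simp only [Matrix.cons_val_zero] at hb0
    exact b.ne_zero 0 hb0

/-- **A non-zero alternating `ℚ[φ]`-balanced form**: with an adapted basis and coordinates `cᵢ`,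
`g(x, y) = c₀(x)c₂(y) - c₂(x)c₀(y) - d (c₁(x)c₃(y) - c₃(x)c₁(y))` (the rational part of the `K`-bilinear
determinant `x₁y₂ - x₂y₁` on `K²`, `K = ℚ(√-d)`) is alternating, satisfies `g(φx, y) = g(x, φy)`, and
`g(b₀, b₂) = 1`. [folklore] -/
private theorem ImaginaryQuadraticRankFour.exists_balancedForm [Module.Finite ℚ V] {φ : Module.End ℚ V} {d : ℚ}
    (hd : 0 < d) (hφ2 : φ * φ = -(d • 1)) (hV : Module.finrank ℚ V = 4) :
    ∃ g : LinearMap.BilinForm ℚ V,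
      (∀ x, g x x = 0) ∧ (∀ x y, g (φ x) y = g x (φ y)) ∧ ∃ x y, g x y ≠ 0 := by
  classical
  obtain ⟨b, h0, h1, h2, h3⟩ := ImaginaryQuadraticRankFour.exists_adaptedBasis hd hφ2 hV
  set M := LinearMap.mul ℚ ℚ with hM
  set g : LinearMap.BilinForm ℚ V :=
    M.compl₁₂ (b.coord 0) (b.coord 2) - M.compl₁₂ (b.coord 2) (b.coord 0) -
      d • (M.compl₁₂ (b.coord 1) (b.coord 3) - M.compl₁₂ (b.coord 3) (b.coord 1)) with hg
  have hgapply : ∀ x y, g x y = b.coord 0 x * b.coord 2 y - b.coord 2 x * b.coord 0 y -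
      d * (b.coord 1 x * b.coord 3 y - b.coord 3 x * b.coord 1 y) := fun x y => by
    simp only [hg, hM, LinearMap.sub_apply, LinearMap.smul_apply, LinearMap.compl₁₂_apply,
      LinearMap.mul_apply', smul_eq_mul]
  -- coordinates of the basis vectors
  have hc : ∀ i j, b.coord i (b j) = if j = i then 1 else 0 := fun i j => by
    rw [Module.Basis.coord_apply, b.repr_self, Finsupp.single_apply]
  refine ⟨g, fun x => by rw [hgapply]; ring, ?_, ⟨b 0, b 2, by
    rw [hgapply]; simp [hc]⟩⟩
  -- `g(φx, y) = g(x, φy)`: check on the basis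
  intro x y
  have key : g.compl₁₂ φ LinearMap.id = g.compl₁₂ LinearMap.id φ := by
    refine LinearMap.BilinForm.ext_basis b fun i j => ?_
    rw [LinearMap.compl₁₂_apply, LinearMap.compl₁₂_apply, LinearMap.id_apply, LinearMap.id_apply]
    fin_cases i <;> fin_cases j <;>
      simp [h0, h1, h2, h3, hgapply, map_neg, map_smul, smul_eq_mul, hc]
  have h := congr_fun₂ (congrArg (fun B : LinearMap.BilinForm ℚ V => fun x y => B x y) key) x y
  simpa only [LinearMap.compl₁₂_apply, LinearMap.id_apply] using h

end Algebra

/-! ### §2 Weight-one tools: `End_Hdg` by `V^{1,0}`, the splitting `V_ℂ = V^{1,0} ⊕ V^{0,1}`, `V^{1,0}` is Lagrangian -/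

section WeightOne

variable {n : ℤ}

/-- For an effective weight-one Hodge structure, a rational operator whose complexification preserves
`V^{1,0}` is a Hodge endomorphism (`F⁰ = V_ℂ`, `F¹ = V^{1,0}`, `F² = 0`). [cite: DeligneHodgeII1971, 1.2.5 and 2.1.6] -/
theorem ImaginaryQuadraticRankFour.mem_endAlg_of_mapsTo_piece (H : HodgeStructure V n) (hn : n = 1)
    (heff : H.IsEffective) {u : Module.End ℚ V}
    (hu : ∀ x ∈ H.piece 1 0, u.baseChange ℂ x ∈ H.piece 1 0) : u ∈ H.endAlg := by
  subst hn
  intro p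
  by_cases hp0 : p ≤ 0
  · rw [heff.F_eq_top hp0]
    exact le_top
  by_cases hp1 : p = 1
  · subst hp1
    rw [← piece_one_zero_eq_F heff]
    rintro _ ⟨x, hx, rfl⟩
    exact hu x hx
  · have hp2 : 2 ≤ p := by omega
    have hF2 : H.F 2 = ⊥ := by
      have hc := H.isCompl_F_complexConj 2 0 (by norm_num)
      rw [heff.F_eq_top le_rfl, complexConj_top] at hc
      exact hc.disjoint.eq_bot_of_le le_top
    have hFp : H.F p = ⊥ := eq_bot_iff.2 ((H.antitone_F hp2).trans hF2.le)
    rw [hFp, Submodule.map_bot]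

/-- `V_ℂ = V^{1,0} ⊕ V^{0,1}` for an effective weight-one Hodge structure. [cite: VoisinHodgeI2002, §7.2.2] -/
theorem ImaginaryQuadraticRankFour.isCompl_piece (H : HodgeStructure V n) (hn : n = 1) (heff : H.IsEffective) :
    IsCompl (H.piece 1 0) (H.piece 0 1) := by
  subst hn
  have h := H.isCompl_F_complexConj 1 1 (by norm_num)
  rwa [← piece_one_zero_eq_F heff, complexConj_piece] at h

/-- **`V^{1,0}` is Lagrangian for `ψ_ℂ`**: if `ψ_ℂ(z, y) = 0` for all `y ∈ V^{1,0}` then `z ∈ V^{1,0}` (write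
`z = z' + z''` along `V^{1,0} ⊕ V^{0,1}`; `ψ_ℂ(V^{1,0}, V^{1,0}) = 0` by the first Hodge–Riemann relation, so
`ψ_ℂ(z'', conj z'') = 0`, and `z'' = 0` by the second). [cite: VoisinHodgeI2002, §7.1.2 Def. 7.7] -/
theorem ImaginaryQuadraticRankFour.mem_piece_of_forall_form_eq_zero (H : HodgeStructure V n) (hn : n = 1)
    (heff : H.IsEffective) (ψ : H.Polarization) {z : ℂ ⊗[ℚ] V}
    (hz : ∀ y ∈ H.piece 1 0, ψ.form.baseChange ℂ z y = 0) : z ∈ H.piece 1 0 := by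
  subst hn
  have hc := ImaginaryQuadraticRankFour.isCompl_piece H rfl heff
  have hmem : z ∈ H.piece 1 0 ⊔ H.piece 0 1 := by
    rw [hc.sup_eq_top]
    exact Submodule.mem_top
  obtain ⟨zp, hzp, zq, hzq, rfl⟩ := Submodule.mem_sup.1 hmem
  have h11 : (1 : ℤ) + 1 - 1 = 1 := by norm_num
  have hzp0 : ∀ y ∈ H.piece 1 0, ψ.form.baseChange ℂ zp y = 0 := fun y hy =>
    ψ.form_apply_eq_zero 1 zp (piece_le_F H 1 0 hzp) y (by rw [h11]; exact piece_le_F H 1 0 hy)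
  have hzq0 : ∀ y ∈ H.piece 1 0, ψ.form.baseChange ℂ zq y = 0 := fun y hy => by
    have h := hz y hy
    rwa [map_add, LinearMap.add_apply, hzp0 y hy, zero_add] at h
  have hzq' : zq = 0 := by
    by_contra hne
    exact ψ.form_conj_ne_zero (p := 0) (q := 1) (by norm_num) hzq hne (hzq0 _ (H.conj_mem_piece hzq))
  rw [hzq', add_zero]
  exact hzp

end WeightOne

/-! ### §3 Base change of bilinear identities -/

section BaseChange

/-- `ψ(u v, w) = g(v, w)` on `V` ⟹ `ψ_ℂ(u_ℂ x, y) = g_ℂ(x, y)` on `V_ℂ`. [folklore] -/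
private theorem ImaginaryQuadraticRankFour.baseChange_apply_left (B B' : LinearMap.BilinForm ℚ V)
    (u : Module.End ℚ V) (h : ∀ v w, B (u v) w = B' v w) (x y : ℂ ⊗[ℚ] V) :
    B.baseChange ℂ (u.baseChange ℂ x) y = B'.baseChange ℂ x y := by
  induction x using TensorProduct.induction_on with
  | zero => simp only [map_zero, LinearMap.zero_apply]
  | tmul a v =>
    induction y using TensorProduct.induction_on with
    | zero => simp only [map_zero]
    | tmul a' w =>
      rw [LinearMap.baseChange_tmul, LinearMap.BilinForm.baseChange_tmul, LinearMap.BilinForm.baseChange_tmul, h]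
    | add y y' hy hy' => rw [map_add, map_add, hy, hy']
  | add x x' hx hx' => simp only [map_add, LinearMap.add_apply, hx, hx']

/-- `ψ(v, u w) = g(v, w)` on `V` ⟹ `ψ_ℂ(x, u_ℂ y) = g_ℂ(x, y)` on `V_ℂ`. [folklore] -/
private theorem ImaginaryQuadraticRankFour.baseChange_apply_right (B B' : LinearMap.BilinForm ℚ V)
    (u : Module.End ℚ V) (h : ∀ v w, B v (u w) = B' v w) (x y : ℂ ⊗[ℚ] V) :
    B.baseChange ℂ x (u.baseChange ℂ y) = B'.baseChange ℂ x y := by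
  induction x using TensorProduct.induction_on with
  | zero => simp only [map_zero, LinearMap.zero_apply]
  | tmul a v =>
    induction y using TensorProduct.induction_on with
    | zero => simp only [map_zero]
    | tmul a' w =>
      rw [LinearMap.baseChange_tmul, LinearMap.BilinForm.baseChange_tmul, LinearMap.BilinForm.baseChange_tmul, h]
    | add y y' hy hy' => rw [map_add, map_add, map_add, hy, hy']
  | add x x' hx hx' => simp only [map_add, LinearMap.add_apply, hx, hx']

/-- `g(v, w) = -g(w, v)` on `V` ⟹ `g_ℂ(x, y) = -g_ℂ(y, x)` on `V_ℂ`. [folklore] -/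
private theorem ImaginaryQuadraticRankFour.baseChange_swap (B : LinearMap.BilinForm ℚ V) (h : ∀ v w, B v w = -B w v)
    (x y : ℂ ⊗[ℚ] V) : B.baseChange ℂ x y = -B.baseChange ℂ y x := by
  induction x using TensorProduct.induction_on with
  | zero => simp only [map_zero, LinearMap.zero_apply, neg_zero]
  | tmul a v =>
    induction y using TensorProduct.induction_on with
    | zero => simp only [map_zero, LinearMap.zero_apply, neg_zero]
    | tmul a' w =>
      rw [LinearMap.BilinForm.baseChange_tmul, LinearMap.BilinForm.baseChange_tmul, h v w, neg_smul, mul_comm]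
    | add y y' hy hy' => rw [map_add, map_add, LinearMap.add_apply, hy, hy', neg_add]
  | add x x' hx hx' => simp only [map_add, LinearMap.add_apply, hx, hx', neg_add]

/-- Eigenvectors of a `g`-balanced operator for distinct eigenvalues are `g`-orthogonal. [folklore] -/
private theorem ImaginaryQuadraticRankFour.form_eq_zero_of_mem_eigenspace {M : Type*} [AddCommGroup M] [Module ℂ M]
    {B : LinearMap.BilinForm ℂ M} {f : Module.End ℂ M} (hbal : ∀ x y, B (f x) y = B x (f y)) {c c' : ℂ}
    (hcc : c ≠ c') {x y : M} (hx : x ∈ Module.End.eigenspace f c) (hy : y ∈ Module.End.eigenspace f c') :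
    B x y = 0 := by
  rw [Module.End.mem_eigenspace_iff] at hx hy
  have h := hbal x y
  rw [hx, hy, LinearMap.map_smul₂, map_smul, smul_eq_mul, smul_eq_mul] at h
  have h' : (c - c') * B x y = 0 := by rw [sub_mul, h, sub_self]
  exact (mul_eq_zero.1 h').resolve_left (sub_ne_zero.2 hcc)

/-- The splitting `x = x₊ + x₋` of `V_ℂ` along the `±μ`-eigenspaces of `φ_ℂ` (`φ² = -d = μ²`), with the explicit
projections `x_± = (2μ)⁻¹ (μ x ± φ_ℂ x)`. [cite: Deligne1982HodgeCycles, §4 (p. 30)] -/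
theorem ImaginaryQuadraticRankFour.decomp {φ : Module.End ℚ V} {d : ℚ} (hφ2 : φ * φ = -(d • 1)) {μ : ℂ}
    (hμ : μ ^ 2 = -(d : ℂ)) (hμ0 : μ ≠ 0) (x : ℂ ⊗[ℚ] V) :
    (2 * μ)⁻¹ • (μ • x + φ.baseChange ℂ x) ∈ Module.End.eigenspace (φ.baseChange ℂ) μ ∧
      (2 * μ)⁻¹ • (μ • x - φ.baseChange ℂ x) ∈ Module.End.eigenspace (φ.baseChange ℂ) (-μ) ∧
        x = (2 * μ)⁻¹ • (μ • x + φ.baseChange ℂ x) + (2 * μ)⁻¹ • (μ • x - φ.baseChange ℂ x) := by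
  have hφφ : φ.baseChange ℂ (φ.baseChange ℂ x) = (μ * μ) • x := by
    rw [UnitaryTheta.baseChange_baseChange_apply hφ2, ← sq, hμ, neg_smul]
  refine ⟨?_, ?_, ?_⟩
  · rw [Module.End.mem_eigenspace_iff, map_smul, map_add, map_smul, hφφ]
    module
  · rw [Module.End.mem_eigenspace_iff, map_smul, map_sub, map_smul, hφφ]
    module
  · rw [← smul_add, add_add_sub_cancel, ← two_smul ℂ, smul_smul, smul_smul, mul_assoc,
      inv_mul_cancel₀ (mul_ne_zero two_ne_zero hμ0), one_smul]

end BaseChange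

/-! ### §4 The two cases: `V^{1,0}` an eigenspace of `φ_ℂ` (multiplicities `(2,0)`), or not (multiplicities `(1,1)`) -/

section Main

variable {n : ℤ}

/-- **Multiplicities `(2,0)` / `(0,2)`.** If `V^{1,0}` meets the `(-μ)`-eigenspace of `φ_ℂ` trivially, then
`V^{1,0}` IS the `μ`-eigenspace (`V^{1,0} ⊆ W_μ` by projecting; `W_μ ⊆ V^{1,0}` because
`V^{0,1} = conj V^{1,0} ⊆ conj W_μ = W_{-μ}` and `W_μ ∩ W_{-μ} = 0`). [cite: HulekLaface2019PicardNumbersAV, Prop. 5.1, exceptional case (3)]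
[cite: Shimura1963AnalyticFamilies, §4 Thm. 5] -/
theorem ImaginaryQuadraticRankFour.piece_eq_eigenspace [Module.Finite ℚ V] (H : HodgeStructure V n) (hn : n = 1)
    (heff : H.IsEffective) {φ : Module.End ℚ V} (hφE : φ ∈ H.endAlg) {d : ℚ} (hd : 0 < d)
    (hφ2 : φ * φ = -(d • 1)) {μ : ℂ} (hμ : μ ^ 2 = -(d : ℂ))
    (hA : H.piece 1 0 ⊓ Module.End.eigenspace (φ.baseChange ℂ) (-μ) = ⊥) :
    H.piece 1 0 = Module.End.eigenspace (φ.baseChange ℂ) μ := by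
  subst hn
  obtain ⟨hμ0, hμc⟩ := UnitaryTheta.conj_eq_neg_of_sq hd hμ
  set P := H.piece 1 0 with hPdef
  set W := Module.End.eigenspace (φ.baseChange ℂ) μ with hWdef
  set W' := Module.End.eigenspace (φ.baseChange ℂ) (-μ) with hW'def
  have hφP : ∀ x ∈ P, φ.baseChange ℂ x ∈ P := fun x hx => endAlg.baseChange_mem_piece ⟨φ, hφE⟩ hx
  have hWW : ∀ x ∈ W, x ∈ W' → x = 0 := by
    intro x hx hx'
    rw [hWdef, Module.End.mem_eigenspace_iff] at hx
    rw [hW'def, Module.End.mem_eigenspace_iff] at hx'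
    have h : μ • x = -μ • x := hx.symm.trans hx'
    have h2 : μ • x + μ • x = 0 := by
      rw [add_eq_zero_iff_eq_neg, ← neg_smul]
      exact h
    rw [← two_smul ℂ, smul_smul] at h2
    exact (smul_eq_zero.1 h2).resolve_left (mul_ne_zero two_ne_zero hμ0)
  apply le_antisymm
  · intro x hx
    obtain ⟨h1, h2, h12⟩ := ImaginaryQuadraticRankFour.decomp hφ2 hμ hμ0 x
    have hx2P : (2 * μ)⁻¹ • (μ • x - φ.baseChange ℂ x) ∈ P :=
      Submodule.smul_mem _ _ (Submodule.sub_mem _ (Submodule.smul_mem _ _ hx) (hφP x hx))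
    have hzero : (2 * μ)⁻¹ • (μ • x - φ.baseChange ℂ x) = 0 := by
      have h : (2 * μ)⁻¹ • (μ • x - φ.baseChange ℂ x) ∈ P ⊓ W' := ⟨hx2P, h2⟩
      rwa [hA, Submodule.mem_bot] at h
    rw [h12, hzero, add_zero]
    exact h1
  · intro w hw
    have hc := ImaginaryQuadraticRankFour.isCompl_piece H rfl heff
    have hmem : w ∈ P ⊔ H.piece 0 1 := by
      rw [hc.sup_eq_top]
      exact Submodule.mem_top
    obtain ⟨p, hp, q, hq, rfl⟩ := Submodule.mem_sup.1 hmem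
    -- `P ≤ W` (first half, re-derived for `conj q ∈ P`)
    have hPW : ∀ x ∈ P, x ∈ W := by
      intro x hx
      obtain ⟨h1, h2, h12⟩ := ImaginaryQuadraticRankFour.decomp hφ2 hμ hμ0 x
      have hx2P : (2 * μ)⁻¹ • (μ • x - φ.baseChange ℂ x) ∈ P :=
        Submodule.smul_mem _ _ (Submodule.sub_mem _ (Submodule.smul_mem _ _ hx) (hφP x hx))
      have hzero : (2 * μ)⁻¹ • (μ • x - φ.baseChange ℂ x) = 0 := by
        have h : (2 * μ)⁻¹ • (μ • x - φ.baseChange ℂ x) ∈ P ⊓ W' := ⟨hx2P, h2⟩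
        rwa [hA, Submodule.mem_bot] at h
      rw [h12, hzero, add_zero]
      exact h1
    have hqW' : q ∈ W' := by
      have h := (UnitaryTheta.conj_mem_eigenspace_iff φ hμc (conj q)).2 (hPW _ (H.conj_mem_piece hq))
      rwa [conj_conj] at h
    have hqW : q ∈ W := by
      have h : q = (p + q) - p := by abel
      rw [h]
      exact Submodule.sub_mem _ hw (hPW p hp)
    rw [hWW q hqW hqW', add_zero]
    exact hp

/-- If `V^{1,0}` is an eigenspace of `φ_ℂ`, every rational operator commuting with `φ` is a Hodge endomorphism.
[cite: HulekLaface2019PicardNumbersAV, Prop. 5.1, exceptional case (3)] -/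
theorem ImaginaryQuadraticRankFour.mem_endAlg_of_commute [Module.Finite ℚ V] (H : HodgeStructure V n)
    (hn : n = 1) (heff : H.IsEffective) {φ : Module.End ℚ V} {c : ℂ}
    (hP : H.piece 1 0 = Module.End.eigenspace (φ.baseChange ℂ) c) {u : Module.End ℚ V}
    (hu : u * φ = φ * u) : u ∈ H.endAlg :=
  ImaginaryQuadraticRankFour.mem_endAlg_of_mapsTo_piece H hn heff fun x hx => by
    rw [hP] at hx ⊢
    exact UnitaryTheta.apply_mem_eigenspace_of_commute (f := φ.baseChange ℂ) (T := u.baseChange ℂ)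
      (by rw [← LinearMap.baseChange_mul, hu, LinearMap.baseChange_mul]) hx

/-- **Multiplicities `(1,1)`.** If `V^{1,0}` meets both eigenspaces of `φ_ℂ`, then for every alternating
`ℚ[φ]`-balanced form `g` on `V` the operator `u` defined by `ψ(u v, w) = g(v, w)` is a Hodge endomorphism
(`g_ℂ` vanishes on `V^{1,0} × V^{1,0}`: the two lines `V^{1,0} ∩ W_{±μ}` are `g_ℂ`-isotropic and `g_ℂ`-orthogonal;
then `u_ℂ V^{1,0} ⊆ (V^{1,0})^{⊥ψ} = V^{1,0}`), and `u ∈ ℚ + ℚφ` forces `g = 0` (a non-zero `a ∈ ℚ + ℚφ` with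
`ψ(a·, ·)` `ℚ[φ]`-balanced contradicts the second Hodge–Riemann relation on `a p`, `p ∈ V^{1,0} ∩ W_μ`).
[cite: HulekLaface2019PicardNumbersAV, Prop. 5.1, exceptional case (4)] [cite: Shimura1963AnalyticFamilies, §4 Thm. 5] -/
theorem ImaginaryQuadraticRankFour.exists_mem_endAlg_of_balancedForm [Module.Finite ℚ V] (H : HodgeStructure V n)
    (hn : n = 1) (heff : H.IsEffective) (ψ : H.Polarization) (hV : Module.finrank ℚ V = 4)
    {φ : Module.End ℚ V} (hφE : φ ∈ H.endAlg) {d : ℚ} (hd : 0 < d) (hφ2 : φ * φ = -(d • 1))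
    {μ : ℂ} (hμ : μ ^ 2 = -(d : ℂ))
    (hB : H.piece 1 0 ⊓ Module.End.eigenspace (φ.baseChange ℂ) μ ≠ ⊥)
    (hB' : H.piece 1 0 ⊓ Module.End.eigenspace (φ.baseChange ℂ) (-μ) ≠ ⊥)
    {g : LinearMap.BilinForm ℚ V} (halt : ∀ x, g x x = 0) (hbal : ∀ x y, g (φ x) y = g x (φ y)) :
    ∃ u ∈ H.endAlg, (∀ v w, ψ.form (u v) w = g v w) ∧
      ((∃ x y : ℚ, u = x • 1 + y • φ) → ∀ v w, g v w = 0) := by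
  subst hn
  classical
  obtain ⟨hμ0, hμc⟩ := UnitaryTheta.conj_eq_neg_of_sq hd hμ
  set φC := φ.baseChange ℂ with hφC
  set P := H.piece 1 0 with hPdef
  set W := Module.End.eigenspace φC μ with hWdef
  set W' := Module.End.eigenspace φC (-μ) with hW'def
  set ψC := ψ.form.baseChange ℂ with hψC
  set gC := g.baseChange ℂ with hgC
  have hφP : ∀ x ∈ P, φC x ∈ P := fun x hx => endAlg.baseChange_mem_piece ⟨φ, hφE⟩ hx
  -- the operator `u = ψ⁻¹ g`
  set u : Module.End ℚ V := (ψ.form.toDual ψ.nondegenerate).symm.toLinearMap ∘ₗ g with hudef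
  have hu : ∀ v w, ψ.form (u v) w = g v w := fun v w => by
    rw [hudef, LinearMap.coe_comp, Function.comp_apply, LinearEquiv.coe_toLinearMap]
    exact LinearMap.BilinForm.apply_toDual_symm_apply (g v) w
  have huC : ∀ x y, ψC (u.baseChange ℂ x) y = gC x y :=
    ImaginaryQuadraticRankFour.baseChange_apply_left ψ.form g u hu
  -- `g_ℂ` is balanced and alternating
  have hgCbal : ∀ x y, gC (φC x) y = gC x (φC y) := fun x y => by
    rw [hgC, hφC, ImaginaryQuadraticRankFour.baseChange_apply_left g (g.compl₁₂ LinearMap.id φ) φ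
        (fun v w => by rw [LinearMap.compl₁₂_apply, LinearMap.id_apply]; exact hbal v w) x y,
      ImaginaryQuadraticRankFour.baseChange_apply_right g (g.compl₁₂ LinearMap.id φ) φ
        (fun v w => by rw [LinearMap.compl₁₂_apply, LinearMap.id_apply]) x y]
  have hskew : ∀ v w, g v w = -g w v := fun v w => by
    have h := halt (v + w)
    simp only [map_add, LinearMap.add_apply, halt v, halt w, zero_add, add_zero] at h
    rw [eq_neg_iff_add_eq_zero, add_comm]
    exact h
  have hgCalt : ∀ x, gC x x = 0 := fun x => by
    have h := ImaginaryQuadraticRankFour.baseChange_swap g hskew x x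
    rw [eq_neg_iff_add_eq_zero] at h
    exact add_self_eq_zero.1 h
  have hμμ : μ ≠ -μ := fun h => hμ0 (by
    rw [eq_neg_iff_add_eq_zero] at h
    exact add_self_eq_zero.1 h)
  have hcross : ∀ a ∈ W, ∀ b ∈ W', gC a b = 0 := fun a ha b hb =>
    ImaginaryQuadraticRankFour.form_eq_zero_of_mem_eigenspace hgCbal hμμ ha hb
  have hcross' : ∀ a ∈ W', ∀ b ∈ W, gC a b = 0 := fun a ha b hb =>
    ImaginaryQuadraticRankFour.form_eq_zero_of_mem_eigenspace hgCbal hμμ.symm ha hb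
  have hWW : ∀ x ∈ W, x ∈ W' → x = 0 := fun x hx hx' => by
    have h := hcross x hx x hx'
    -- a vector in both eigenspaces: `μ x = -μ x`
    rw [hWdef, Module.End.mem_eigenspace_iff] at hx
    rw [hW'def, Module.End.mem_eigenspace_iff] at hx'
    have h1 : μ • x = -μ • x := hx.symm.trans hx'
    have h2 : μ • x + μ • x = 0 := by
      rw [add_eq_zero_iff_eq_neg, ← neg_smul]
      exact h1
    rw [← two_smul ℂ, smul_smul] at h2
    exact (smul_eq_zero.1 h2).resolve_left (mul_ne_zero two_ne_zero hμ0)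
  -- `dim V^{1,0} = 2`
  have hP2 : Module.finrank ℂ P = 2 := by
    have hPQ := ImaginaryQuadraticRankFour.isCompl_piece H rfl heff
    have h := Submodule.finrank_sup_add_finrank_inf_eq P (H.piece 0 1)
    rw [hPQ.sup_eq_top, hPQ.inf_eq_bot, finrank_top, finrank_bot, add_zero, Module.finrank_baseChange, hV] at h
    have hsymm : Module.finrank ℂ P = Module.finrank ℂ (H.piece 0 1) := hodgeNumber_symm_holds H 1 0
    omega
  -- `V^{1,0} = (V^{1,0} ∩ W) ⊕ (V^{1,0} ∩ W')`, two lines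
  have hdecP : ∀ x ∈ P, ∃ x₁ ∈ P ⊓ W, ∃ x₂ ∈ P ⊓ W', x = x₁ + x₂ := by
    intro x hx
    obtain ⟨h1, h2, h12⟩ := ImaginaryQuadraticRankFour.decomp hφ2 hμ hμ0 x
    exact ⟨_, ⟨Submodule.smul_mem _ _ (Submodule.add_mem _ (Submodule.smul_mem _ _ hx) (hφP x hx)), h1⟩, _,
      ⟨Submodule.smul_mem _ _ (Submodule.sub_mem _ (Submodule.smul_mem _ _ hx) (hφP x hx)), h2⟩, h12⟩
  have hsupP : (P ⊓ W) ⊔ (P ⊓ W') = P := by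
    refine le_antisymm (sup_le inf_le_left inf_le_left) fun x hx => ?_
    obtain ⟨x₁, hx₁, x₂, hx₂, rfl⟩ := hdecP x hx
    exact Submodule.add_mem_sup hx₁ hx₂
  have hinfP : (P ⊓ W) ⊓ (P ⊓ W') = ⊥ := by
    rw [eq_bot_iff]
    intro x hx
    rw [Submodule.mem_bot]
    exact hWW x hx.1.2 hx.2.2
  have hranks : Module.finrank ℂ ↥(P ⊓ W) = 1 ∧ Module.finrank ℂ ↥(P ⊓ W') = 1 := by
    have h := Submodule.finrank_sup_add_finrank_inf_eq (P ⊓ W) (P ⊓ W')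
    rw [hsupP, hinfP, finrank_bot, add_zero, hP2] at h
    have h1 : Module.finrank ℂ ↥(P ⊓ W) ≠ 0 := fun h0 => hB (Submodule.finrank_eq_zero.1 h0)
    have h2 : Module.finrank ℂ ↥(P ⊓ W') ≠ 0 := fun h0 => hB' (Submodule.finrank_eq_zero.1 h0)
    omega
  -- `g_ℂ` vanishes on a line
  have hdiag : ∀ S : Submodule ℂ (ℂ ⊗[ℚ] V), Module.finrank ℂ S = 1 → ∀ a ∈ S, ∀ b ∈ S, gC a b = 0 := by
    intro S hS a ha b hb
    by_cases ha0 : a = 0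
    · rw [ha0, map_zero, LinearMap.zero_apply]
    · have hne : (⟨a, ha⟩ : S) ≠ 0 := fun h => ha0 (congrArg Subtype.val h)
      obtain ⟨c, hc⟩ := (finrank_eq_one_iff_of_nonzero' (⟨a, ha⟩ : S) hne).1 hS ⟨b, hb⟩
      have hc' : c • a = b := by simpa using congrArg Subtype.val hc
      rw [← hc', map_smul, smul_eq_mul, hgCalt a, mul_zero]
  -- hence on `V^{1,0} × V^{1,0}`
  have hgP : ∀ x ∈ P, ∀ y ∈ P, gC x y = 0 := by
    intro x hx y hy
    obtain ⟨x₁, hx₁, x₂, hx₂, rfl⟩ := hdecP x hx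
    obtain ⟨y₁, hy₁, y₂, hy₂, rfl⟩ := hdecP y hy
    simp only [map_add, LinearMap.add_apply]
    rw [hdiag _ hranks.1 x₁ hx₁ y₁ hy₁, hcross x₁ hx₁.2 y₂ hy₂.2, hcross' x₂ hx₂.2 y₁ hy₁.2,
      hdiag _ hranks.2 x₂ hx₂ y₂ hy₂]
    norm_num
  -- `u` is a Hodge endomorphism
  have huE : u ∈ H.endAlg :=
    ImaginaryQuadraticRankFour.mem_endAlg_of_mapsTo_piece H rfl heff fun x hx =>
      ImaginaryQuadraticRankFour.mem_piece_of_forall_form_eq_zero H rfl heff ψ fun y hy => by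
        rw [← hψC, huC]
        exact hgP x hx y hy
  refine ⟨u, huE, hu, ?_⟩
  rintro ⟨s, t, hst⟩
  by_cases h00 : s = 0 ∧ t = 0
  · obtain ⟨rfl, rfl⟩ := h00
    rw [zero_smul, zero_smul, add_zero] at hst
    intro v w
    rw [← hu, hst, LinearMap.zero_apply, map_zero, LinearMap.zero_apply]
  · exfalso
    obtain ⟨p, hp, hp0⟩ := (Submodule.ne_bot_iff _).1 hB
    set lam : ℂ := (s : ℂ) + (t : ℂ) * μ with hlamdef
    have hlam : lam ≠ 0 := by
      intro h0
      by_cases ht : t = 0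
      · subst ht
        have hs : (s : ℂ) = 0 := by simpa [hlamdef] using h0
        exact h00 ⟨by exact_mod_cast hs, rfl⟩
      · have ht' : (t : ℂ) ≠ 0 := by exact_mod_cast ht
        have hμst : μ = -((s : ℂ) / (t : ℂ)) := by
          field_simp
          linear_combination h0
        have h2 := hμ
        rw [hμst, neg_sq] at h2
        have h3 : (s / t) ^ 2 = -d := by exact_mod_cast h2
        nlinarith [sq_nonneg (s / t)]
    have hap : u.baseChange ℂ p = lam • p := by
      have hφp : φC p = μ • p := Module.End.mem_eigenspace_iff.1 hp.2
      rw [hst, LinearMap.baseChange_add, LinearMap.baseChange_smul, LinearMap.baseChange_smul,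
        LinearMap.baseChange_one, LinearMap.add_apply, LinearMap.smul_apply, LinearMap.smul_apply,
        Module.End.one_apply, ← hφC, hφp, ← algebraMap_smul ℂ s p, ← algebraMap_smul ℂ t (μ • p), smul_smul,
        ← add_smul, eq_ratCast, eq_ratCast]
    have hlp : lam • p ∈ P := Submodule.smul_mem _ _ hp.1
    have hne : lam • p ≠ 0 := smul_ne_zero hlam hp0
    have hconj : conj p ∈ W' := (UnitaryTheta.conj_mem_eigenspace_iff φ hμc p).2 hp.2
    refine ψ.form_conj_ne_zero (p := 1) (q := 0) (by norm_num) hlp hne ?_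
    rw [conj_smul, map_smul, ← hap, ← hψC, huC, hcross p hp.2 (conj p) hconj, smul_zero]

/-- **Theorem (no imaginary quadratic `End_Hdg` in rank four).** Let `H` be an effective polarized `ℚ`-Hodge
structure of weight `1` with `dim_ℚ V = 4`, and `φ ∈ End_Hdg(V)` with `φ² = -d`, `d > 0` (so `ℚ[φ] ≅ ℚ(√-d)`
is an imaginary quadratic field of Hodge endomorphisms). Then there is a Hodge endomorphism `u ∉ ℚ + ℚφ`.
For the `H¹` of a complex abelian surface `X` this is Shimura's theorem that `End⁰(X)` is never an imaginary
quadratic field (the signatures `(2,0)` and `(1,1)` being the exceptional cases (3) and (4) of Shimura's list: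
`X ∼ E²` with `E` CM, resp. `End⁰(X) ⊇` an indefinite quaternion algebra); Moonen–Zarhin (2.2): for a simple
abelian surface "there are four cases" (types I(1), I(2), II(1), IV(2,1)). [cite: MoonenZarhin1999LowDim, §2 (2.2) (p. 715)]
[cite: HulekLaface2019PicardNumbersAV, Prop. 5.1, exceptional cases (3)–(4) and proof] [cite: Shimura1963AnalyticFamilies, §4 Thm. 5] -/
theorem ImaginaryQuadraticRankFour.exists_mem_endAlg_not_mem [Module.Finite ℚ V] (H : HodgeStructure V n)
    (hn : n = 1) (heff : H.IsEffective) (ψ : H.Polarization) (hV : Module.finrank ℚ V = 4)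
    {φ : Module.End ℚ V} (hφE : φ ∈ H.endAlg) {d : ℚ} (hd : 0 < d) (hφ2 : φ * φ = -(d • 1)) :
    ∃ u ∈ H.endAlg, ¬ ∃ x y : ℚ, u = x • 1 + y • φ := by
  subst hn
  classical
  -- a square root of `-d`
  have hd' : (0 : ℝ) ≤ (d : ℝ) := by exact_mod_cast hd.le
  obtain ⟨μ, hμ⟩ : ∃ μ : ℂ, μ ^ 2 = -(d : ℂ) :=
    ⟨Complex.I * (Real.sqrt d : ℂ), by
      rw [mul_pow, Complex.I_sq, ← Complex.ofReal_pow, Real.sq_sqrt hd', Complex.ofReal_ratCast]; ring⟩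
  obtain ⟨π, hπφ, hπ⟩ := ImaginaryQuadraticRankFour.exists_commuting_not_mem hd hφ2 hV
  by_cases hA : H.piece 1 0 ⊓ Module.End.eigenspace (φ.baseChange ℂ) (-μ) = ⊥
  · exact ⟨π, ImaginaryQuadraticRankFour.mem_endAlg_of_commute H rfl heff
      (ImaginaryQuadraticRankFour.piece_eq_eigenspace H rfl heff hφE hd hφ2 hμ hA) hπφ, hπ⟩
  by_cases hA' : H.piece 1 0 ⊓ Module.End.eigenspace (φ.baseChange ℂ) μ = ⊥
  · have hμ' : (-μ) ^ 2 = -(d : ℂ) := by rw [neg_sq]; exact hμ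
    have hA'' : H.piece 1 0 ⊓ Module.End.eigenspace (φ.baseChange ℂ) (-(-μ)) = ⊥ := by rw [neg_neg]; exact hA'
    exact ⟨π, ImaginaryQuadraticRankFour.mem_endAlg_of_commute H rfl heff
      (ImaginaryQuadraticRankFour.piece_eq_eigenspace H rfl heff hφE hd hφ2 hμ' hA'') hπφ, hπ⟩
  · obtain ⟨g, halt, hbal, v₀, w₀, hg0⟩ := ImaginaryQuadraticRankFour.exists_balancedForm hd hφ2 hV
    obtain ⟨u, huE, -, hK⟩ := ImaginaryQuadraticRankFour.exists_mem_endAlg_of_balancedForm H rfl heff ψ hV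
      hφE hd hφ2 hμ hA' hA halt hbal
    exact ⟨u, huE, fun hmem => hg0 (hK hmem v₀ w₀)⟩

/-- The same, negating the shape of the hypothesis `hE` of the tree's `UnitaryTheta` files: in rank four,
`End_Hdg(V) = ℚ + ℚφ` with `φ² = -d < 0` is impossible. [cite: MoonenZarhin1999LowDim, §2 (2.2) (p. 715)]
[cite: Shimura1963AnalyticFamilies, §4 Thm. 5] -/
theorem ImaginaryQuadraticRankFour.not_forall_mem_endAlg_eq [Module.Finite ℚ V] (H : HodgeStructure V n)
    (hn : n = 1) (heff : H.IsEffective) (ψ : H.Polarization) (hV : Module.finrank ℚ V = 4)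
    {φ : Module.End ℚ V} (hφE : φ ∈ H.endAlg) {d : ℚ} (hd : 0 < d) (hφ2 : φ * φ = -(d • 1)) :
    ¬ ∀ a ∈ H.endAlg, ∃ x y : ℚ, a = x • 1 + y • φ := fun hE => by
  obtain ⟨u, huE, hu⟩ := ImaginaryQuadraticRankFour.exists_mem_endAlg_not_mem H hn heff ψ hV hφE hd hφ2
  exact hu (hE u huE)

/-- **`dim_ℚ End_Hdg(V) ≥ 3`** under the same hypotheses (`1, φ, u` are linearly independent).
[cite: MoonenZarhin1999LowDim, §2 (2.2) (p. 715)] [cite: Shimura1963AnalyticFamilies, §4 Thm. 5] -/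
theorem ImaginaryQuadraticRankFour.three_le_finrank_endAlg [Module.Finite ℚ V] (H : HodgeStructure V n)
    (hn : n = 1) (heff : H.IsEffective) (ψ : H.Polarization) (hV : Module.finrank ℚ V = 4)
    {φ : Module.End ℚ V} (hφE : φ ∈ H.endAlg) {d : ℚ} (hd : 0 < d) (hφ2 : φ * φ = -(d • 1)) :
    3 ≤ Module.finrank ℚ H.endAlg := by
  classical
  obtain ⟨u, huE, hu⟩ := ImaginaryQuadraticRankFour.exists_mem_endAlg_not_mem H hn heff ψ hV hφE hd hφ2
  haveI : Nontrivial V := Module.nontrivial_of_finrank_pos (R := ℚ) (by omega)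
  have hli : LinearIndependent ℚ ![(1 : Module.End ℚ V), φ, u] := by
    rw [Fintype.linearIndependent_iff]
    intro c hc
    rw [Fin.sum_univ_three] at hc
    simp only [Matrix.cons_val_zero, Matrix.cons_val_one, Matrix.cons_val] at hc
    have hc2 : c 2 = 0 := by
      by_contra hne
      apply hu
      refine ⟨-(c 0 / c 2), -(c 1 / c 2), ?_⟩
      have h1 : c 2 • u = -(c 0 • 1 + c 1 • φ) := by
        rw [eq_neg_iff_add_eq_zero, ← hc]
        abel
      calc u = (c 2)⁻¹ • (c 2 • u) := by rw [smul_smul, inv_mul_cancel₀ hne, one_smul]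
        _ = -(c 0 / c 2) • 1 + -(c 1 / c 2) • φ := by
          rw [h1, smul_neg, smul_add, smul_smul, smul_smul, neg_add, ← neg_smul, ← neg_smul, div_eq_inv_mul,
            div_eq_inv_mul]
    rw [hc2, zero_smul, add_zero] at hc
    have hpair : c 0 = 0 ∧ c 1 = 0 := by
      by_cases h1 : c 1 = 0
      · rw [h1, zero_smul, add_zero, smul_eq_zero] at hc
        exact ⟨hc.resolve_right one_ne_zero, h1⟩
      · exfalso
        have hφeq : φ = (-(c 0 / c 1)) • (1 : Module.End ℚ V) := by
          have h : c 1 • φ = -(c 0 • 1) := eq_neg_of_add_eq_zero_right hc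
          calc φ = (c 1)⁻¹ • (c 1 • φ) := by rw [smul_smul, inv_mul_cancel₀ h1, one_smul]
            _ = _ := by rw [h, smul_neg, smul_smul, neg_smul, div_eq_inv_mul]
        have hsq : ((c 0 / c 1) ^ 2 + d) • (1 : Module.End ℚ V) = 0 := by
          have h := hφ2
          rw [hφeq, smul_mul_smul_comm, mul_one, neg_mul_neg, ← sq] at h
          rw [add_smul, h, neg_add_cancel]
        rcases smul_eq_zero.1 hsq with h | h
        · have : (0 : ℚ) < (c 0 / c 1) ^ 2 + d := by positivity
          exact this.ne' h
        · exact one_ne_zero h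
    intro i
    fin_cases i
    exacts [hpair.1, hpair.2, hc2]
  have hle : Submodule.span ℚ (Set.range ![(1 : Module.End ℚ V), φ, u]) ≤ Subalgebra.toSubmodule H.endAlg := by
    rw [Submodule.span_le]
    rintro _ ⟨i, rfl⟩
    fin_cases i
    exacts [H.endAlg.one_mem, hφE, huE]
  have h := Submodule.finrank_mono hle
  rw [finrank_span_eq_card hli, Fintype.card_fin, Subalgebra.finrank_toSubmodule] at h
  exact h

end Main

end HodgeStructure

end Literature.AlgebraicGeometry.Motives

end
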